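import Summits.BirchSwinnertonDyer.BirchSwinnertonDyer.Theorems.TeichmullerTwistDescentTameGoodModelOfTateProfile
import HarnessLib

/-!
# Route `TeichmullerTwistDescent`: Kodaira III / III* at an odd prime ⇒ `HasTameGoodModel p e W (e/4)` / `(3e/4)` —
# the Néron-differential jumps `1/4` and `3/4` of the TTD thesis, typed and proved (`--supports` PSMU,
# stmt-BirchSwinnertonDyer-22638; route-independent module)

Cell `pub/bsd-wall`, D-0145 line `route-BirchSwinnertonDyer-TeichmullerTwistDescent`, seat `bsd-line-ttd-p1` g15.
BSD is NOT proved by this; Manin's conjecture is not proved by this; no route item is closed. THEOREMS ONLY; imports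
no route file. Sequel of `TeichmullerTwistDescentTameGoodModelOfTateProfile` (`hasTameGoodModel_of_tateProfile`):
feeding it the tree's ℚ-rational Tate normal forms `exists_variableChange_tateNormalForm_III` (profile `(1,1,1,1,2)`,
`ord_p Δ = 3`) and `…_IIIstar` (`(1,2,3,3,5)`, `ord_p Δ = 9`) gives, for every `e` with `4 ∣ e`:

* `hasTameGoodModel_of_kodairaSymbolAt_III`: type III at the place over an odd prime `p` ⇒ `HasTameGoodModel p e W (e/4)`;
* `hasTameGoodModel_of_kodairaSymbolAt_IIIstar`: type III* ⇒ `HasTameGoodModel p e W (3e/4)`.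

So the Néron differential of `W` over `ℚ(ϖ)`, `ϖ^e = −p`, is `ϖ^{e/4}·ω_W` (resp. `ϖ^{3e/4}·ω_W`): the jump
`a/e = ord_p Δ_min/12 ∈ {1/4, 3/4}` of the route thesis («Gauss-sum valuation = Néron jump», memo MECHANISM-K-lattice §4,
item K4) for two of the six tame Kodaira types. At `(p, e) = (3, 8)` these are TQMP's LINE-41 statements S41 (`a = 2`,
`IIIGoodModel.tprimeIIIHasTameGoodModel_proof`) and S41* (`a = 6`); at `e = 4` they are the hypothesis under which the
carrier `TameNeronFormsAt N p 4` (N38b/N38c: `p ∤ c ⟺ col_K ≤ a`) reads TTD's III rows (GE11 at `p ≥ 11`, the Kummer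
corner `(5, III)` of stmt-23883/24306/24307).

References: [SilvermanATAEC1994] IV.9.4 Steps 4 and 9, Table 4.1; [EdixhovenManin1991] Prop. 4 (exponents `1/4`, `3/4`).
-/

set_option autoImplicit false
-- D-0017: single-problem summit, so `Summit.BirchSwinnertonDyer.BirchSwinnertonDyer.…` repeats a namespace BY DESIGN.
set_option linter.dupNamespace false

noncomputable section

open scoped Classical

open WeierstrassCurve IsDedekindDomain IsDedekindDomain.HeightOneSpectrum Rat.HeightOneSpectrum WithZero
  Literature.NumberTheory.EllipticCurves Literature.NumberTheory.EllipticCurves.ModularForms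
  Literature.NumberTheory.DiophantineGeometry Summit.BirchSwinnertonDyer.Rank1Residual.Additive

namespace Summit.BirchSwinnertonDyer.BirchSwinnertonDyer.Theorems.TeichmullerTwistDescent.TameGoodModel

variable (p : ℕ) [hp : Fact p.Prime]

/-- **Kodaira III at an odd prime: `HasTameGoodModel p e W (e/4)` for every `e` with `4 ∣ e`** — the Néron
differential of `W` over `ℚ(ϖ)`, `ϖ^e = −p`, is `ϖ^{e/4}·ω_W`, i.e. the jump is `1/4 = ord_p Δ_min/12`
(Tate's algorithm Step 4: profile `(1,1,1,1,2)`, `ord_p Δ = 3`, made ℚ-rational by the tree's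
`exists_variableChange_tateNormalForm_III`). [cite: SilvermanATAEC1994, IV.9.4 Step 4 and Table 4.1]
[cite: EdixhovenManin1991, Prop. 4 (the exponent 1/4 for type III)] -/
theorem hasTameGoodModel_of_kodairaSymbolAt_III (hp2 : p ≠ 2) {e : ℕ} (he : 0 < e) (he4 : 4 ∣ e)
    (W : WeierstrassCurve ℚ) [W.IsElliptic] [W.IsGloballyMinimal] (hK : W.kodairaSymbolAt (placeOf p) = .III) :
    HasTameGoodModel p e W (e / 4) := by
  haveI : PerfectField (IsLocalRing.ResidueField ((placeOf p).adicCompletionIntegers ℚ)) := PerfectField.ofFinite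
  have h2 : ringChar (ℤ ⧸ (placeOf p).asIdeal) ≠ 2 := by rw [ringChar_int_quot_placeOf p]; exact hp2
  obtain ⟨C, c₁, c₂, c₃, c₄, c₆, cΔ⟩ := W.exists_variableChange_tateNormalForm_III (placeOf p) h2 hK
  have hord : padicValInt p W.minimalDiscriminantInt = 3 := by
    have h := W.ordMinimalDiscriminant_eq_numComponentsAt_add_one_of_kodairaSymbolAt (placeOf p) h2 (Or.inl hK)
    rw [ordMinimalDiscriminant_placeOf_eq W p] at h
    unfold numComponentsAt at h
    rw [hK] at h
    simpa [KodairaSymbol.numComponents] using h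
  obtain ⟨e', rfl⟩ := he4
  rw [show 4 * e' / 4 = e' by omega]
  exact hasTameGoodModel_of_tateProfile p he W C (k₁ := 1) (k₂ := 1) (k₃ := 1) (k₄ := 1) (k₆ := 2) (d := 3)
    (by simpa using c₁) (by simpa using c₂) (by simpa using c₃) (by simpa using c₄) (by simpa using c₆)
    (by simpa using cΔ) hord (by omega) (by omega) (by omega) (by omega) (by omega) (by omega)

/-- **Kodaira III* at an odd prime: `HasTameGoodModel p e W (3e/4)` for every `e` with `4 ∣ e`** — the Néron jump
is `3/4 = ord_p Δ_min/12` (Step 9: profile `(1,2,3,3,5)`, `ord_p Δ = 9`;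
`exists_variableChange_tateNormalForm_IIIstar`). [cite: SilvermanATAEC1994, IV.9.4 Step 9 and Table 4.1]
[cite: EdixhovenManin1991, Prop. 4 (the exponent 3/4 for type III*)] -/
theorem hasTameGoodModel_of_kodairaSymbolAt_IIIstar (hp2 : p ≠ 2) {e : ℕ} (he : 0 < e) (he4 : 4 ∣ e)
    (W : WeierstrassCurve ℚ) [W.IsElliptic] [W.IsGloballyMinimal]
    (hK : W.kodairaSymbolAt (placeOf p) = .IIIstar) : HasTameGoodModel p e W (3 * e / 4) := by
  haveI : PerfectField (IsLocalRing.ResidueField ((placeOf p).adicCompletionIntegers ℚ)) := PerfectField.ofFinite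
  have h2 : ringChar (ℤ ⧸ (placeOf p).asIdeal) ≠ 2 := by rw [ringChar_int_quot_placeOf p]; exact hp2
  obtain ⟨C, c₁, c₂, c₃, c₄, c₆, cΔ⟩ := W.exists_variableChange_tateNormalForm_IIIstar (placeOf p) h2 hK
  have hord : padicValInt p W.minimalDiscriminantInt = 9 := by
    have h := W.ordMinimalDiscriminant_eq_numComponentsAt_add_one_of_kodairaSymbolAt (placeOf p) h2
      (Or.inr (Or.inl hK))
    rw [ordMinimalDiscriminant_placeOf_eq W p] at h
    unfold numComponentsAt at h
    rw [hK] at h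
    simpa [KodairaSymbol.numComponents] using h
  obtain ⟨e', rfl⟩ := he4
  rw [show 3 * (4 * e') / 4 = 3 * e' by omega]
  exact hasTameGoodModel_of_tateProfile p he W C (k₁ := 1) (k₂ := 2) (k₃ := 3) (k₄ := 3) (k₆ := 5) (d := 9)
    (by simpa using c₁) (by simpa using c₂) (by simpa using c₃) (by simpa using c₄) (by simpa using c₆)
    (by simpa using cΔ) hord (by omega) (by omega) (by omega) (by omega) (by omega) (by omega)

/-- **The additive rows `ord_p Δ_min = 3` at `p ≥ 5` (TTD currency: `Addv W p`, Kodaira III by Table 4.1):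
`HasTameGoodModel p e W (e/4)` for `4 ∣ e`** — in particular `HasTameGoodModel 5 4 W 1` on the Kummer corner
`(5, III)` of stmt-23883/24306/24307 and on GE11's type-III rows (stmt-23885), the hypothesis under which the carrier
`TameNeronFormsAt N p e` turns `p ∤ c` into a colength bound. [cite: SilvermanATAEC1994, IV Table 4.1] -/
theorem hasTameGoodModel_of_addv_of_padicValInt_eq_three (hp5 : 5 ≤ p) {e : ℕ} (he : 0 < e) (he4 : 4 ∣ e)
    (W : WeierstrassCurve ℚ) [W.IsElliptic] [W.IsGloballyMinimal] (hadd : Rank1Residual.Addv W p)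
    (h3 : padicValInt p W.minimalDiscriminantInt = 3) : HasTameGoodModel p e W (e / 4) :=
  hasTameGoodModel_of_kodairaSymbolAt_III p (by omega) he he4 W
    ((kodairaSymbolAt_placeOf_eq_III_iff_of_addv W p hp5 hadd).mpr h3)

end Summit.BirchSwinnertonDyer.BirchSwinnertonDyer.Theorems.TeichmullerTwistDescent.TameGoodModel

end
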